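import Mathlib
import Summits.AtomisticToContinuum.Crystallization.Theorems.FrustratedLawDichotomyPeriodicRemovalTest
import Summits.AtomisticToContinuum.Crystallization.Theorems.FrustratedLawDichotomyGSCSurgeryCertificates

/-!
# FrustratedLawDichotomy · cruxes `AperiodicFrustratedLawGap` / `PeriodicFrustratedLawGap` (stmt-AtomisticToContinuum-27623 / 27624) —
# AN EXACT PERIODIC MINIMISER IS AN `e(Q)`-μGSC: THE UNCONDITIONAL FINITE-SURGERY TEST (periodic case of the μ-equilibrium door, door-free)
# (decomp-a2c, prover hand 2, structural share, generation 5)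

`eStar_lt_energyPerParticle_of_surgery_periodic`: let `Q` be a `δ`-separated periodic configuration of `ℝ³`; remove `n ≥ 1` distinct atoms `xf`
of `Q` and insert `k` distinct atoms `R` off `Q ∖ xf`.  If the surgery balance beats `e(Q)·(k − n)` —
`[U(R) + Σ_i I(R_i, Q∖xf)] − [U(xf) + Σ_i I(xf_i, Q∖xf)] < e(Q)·(k − n)` — then `e⋆ < e(Q)`.  Equivalently: an EXACT periodic minimiser
(`e(Q) = e⋆`) satisfies every Sütő μGSC inequality at `μ = e⋆` with `n ≥ 1` — the periodic case of `GrainCoreNetworkSplit.MuEquilibriumDoor`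
(item 27073), proved here WITHOUT the unbuilt `EquilibriumInLaw` chain, without any bound on `e⋆` and without `½R` corrections; it makes
`FrustratedLawDichotomyGSCSurgeryTests.eStar_lt_energyPerParticle_of_surgery` door-free for `n ≥ 1` (pure insertions `n = 0` are not treated).

Proof (surgery in a supercell).  `k = 0` is `FrustratedLawDichotomyPeriodicRemovalTest`.  For `k ≥ 1` re-present `Q` with lattice `KΛ`
(`FrustratedLawDichotomyPeriodicSupercell`), delete the `KΛ`-orbits of `xf` from the motif and ADD the `k` points `R` to it: the resulting
periodic configuration `A⁺` (points `(Q ∖ (xf + KΛ)) ∪ (R + KΛ)`) has `e⋆ ≤ e(A⁺)`, and the site-sum bookkeeping of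
`FrustratedLawDichotomyPeriodicSubconfiguration` gives `2(#A + k)·e(A⁺) = 2·#M'·e(Q) + 2Δ_A − Σ G + Σ H − …` where the far lattice copies of
the removed cluster and of the inserted atoms (all at distance `≥ Kδ − 2ρ − 1 =: Rc ≥ 1`) contribute only through non-positive terms EXCEPT the
bonds between an inserted atom and the far copies of the removed cluster, which are bounded by the explicit `r⁻⁶` tail
`k·T(δ, Rc)` (`FrustratedLawDichotomyGSCSurgeryCertificates.abs_tsum_lennardJones_sub_sum_le`); `K` is chosen so large that this tail is
below the gap `e(Q)(k − n) − Δ`.  All `[folklore]`.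
-/

noncomputable section

namespace Summit.AtomisticToContinuum.Crystallization.Theorems.FrustratedLawDichotomyPeriodicSurgeryTest

open Literature.MathematicalPhysics.StatisticalMechanics
open Summit.AtomisticToContinuum.Crystallization.Theorems.ChargedEnergyGapNegative (E3 eStar eStar_le)
open Summit.AtomisticToContinuum.Crystallization.Theorems.FrustratedLawDichotomyPeriodicSubconfiguration
open Summit.AtomisticToContinuum.Crystallization.Theorems.FrustratedLawDichotomyPeriodicSupercell (exists_supercell_points_energy tsum_site_eq_of_sub_mem_lattice)
open Summit.AtomisticToContinuum.Crystallization.Theorems.FrustratedLawDichotomyPeriodicRemovalTest (le_norm_of_mem_lattice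
  eStar_lt_energyPerParticle_of_underboundCluster_periodic)
open Summit.AtomisticToContinuum.Crystallization.Theorems.FrustratedLawDichotomyGSCSurgeryCertificates (abs_tsum_lennardJones_sub_sum_le)

/-- **AN EXACT PERIODIC MINIMISER IS AN `e(Q)`-μGSC (surgeries with `n ≥ 1`), census form.**  `Q` `δ`-separated periodic; `xf` : `n ≥ 1` distinct
atoms of `Q`; `R` : `k` distinct new positions off `Q ∖ xf`; if `[U(R) + Σ_i I(R_i, Q∖xf)] − [U(xf) + Σ_i I(xf_i, Q∖xf)] < e(Q)·(k − n)` then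
`e⋆ < e(Q)`.  Unconditional (no door, no bound on `e⋆`). [folklore] -/
theorem eStar_lt_energyPerParticle_of_surgery_periodic (Q : PeriodicConfiguration 3) {δ : ℝ} (hδ : 0 < δ) (hsep : ∀ p ∈ Q.points, ∀ q ∈ Q.points, p ≠ q → δ ≤ dist p q)
    {n : ℕ} (hnpos : 0 < n) {xf : Fin n → E3} (hxf : Function.Injective xf) (hX : Set.range xf ⊆ Q.points)
    {k : ℕ} {R : Fin k → E3} (hR : Function.Injective R) (hRdisj : Disjoint (Set.range R) (Q.points \ Set.range xf))
    (hviol : (interactionEnergy lennardJones R + ∑ i, ∑' y : ↥(Q.points \ Set.range xf), lennardJones (dist (R i) y)) -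
        (interactionEnergy lennardJones xf + ∑ i, ∑' y : ↥(Q.points \ Set.range xf), lennardJones (dist (xf i) y)) <
        Q.energyPerParticle lennardJones * ((k : ℝ) - n)) :
    (⨅ Q' : PeriodicConfiguration 3, Q'.energyPerParticle lennardJones) < Q.energyPerParticle lennardJones := by
  classical
  rcases Nat.eq_zero_or_pos k with hk0 | hkpos
  · subst hk0
    refine eStar_lt_energyPerParticle_of_underboundCluster_periodic Q hδ hsep hxf hX ?_; rw [interactionEnergy_of_subsingleton, Finset.sum_of_isEmpty] at hviol
    simp only [Nat.cast_zero, zero_add, zero_sub, mul_neg] at hviol; linarith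
  by_contra hle; rw [not_lt] at hle; set e : ℝ := Q.energyPerParticle lennardJones with he_def
  have heq : e = ⨅ Q' : PeriodicConfiguration 3, Q'.energyPerParticle lennardJones := le_antisymm hle (eStar_le Q)
  set Δ : ℝ := (interactionEnergy lennardJones R + ∑ i, ∑' y : ↥(Q.points \ Set.range xf), lennardJones (dist (R i) y)) -
        (interactionEnergy lennardJones xf + ∑ i, ∑' y : ↥(Q.points \ Set.range xf), lennardJones (dist (xf i) y)) with hΔ
  set γ : ℝ := e * ((k : ℝ) - n) - Δ with hγ; have hγpos : 0 < γ := by rw [hγ]; linarith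
  set ρ : ℝ := ∑ i, ‖xf i‖ + ∑ i, ‖R i‖ with hρ_def
  have hρx : ∀ i, ‖xf i‖ ≤ ρ := fun i => by
    have h1 := Finset.single_le_sum (f := fun i => ‖xf i‖) (fun _ _ => norm_nonneg _) (Finset.mem_univ i); have h2 : (0 : ℝ) ≤ ∑ i, ‖R i‖ := Finset.sum_nonneg fun _ _ => norm_nonneg _
    linarith
  have hρR : ∀ i, ‖R i‖ ≤ ρ := fun i => by
    have h1 := Finset.single_le_sum (f := fun i => ‖R i‖) (fun _ _ => norm_nonneg _) (Finset.mem_univ i); have h2 : (0 : ℝ) ≤ ∑ i, ‖xf i‖ := Finset.sum_nonneg fun _ _ => norm_nonneg _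
    linarith
  have hρ0 : 0 ≤ ρ := (norm_nonneg _).trans (hρx ⟨0, hnpos⟩); have hd2 : ∀ u v : E3, ‖u‖ ≤ ρ → ‖v‖ ≤ ρ → ‖u - v‖ ≤ 2 * ρ := fun u v hu hv => (norm_sub_le _ _).trans (by linarith)
  obtain ⟨g₁, hg₁Λ, hg₁0⟩ : ∃ g ∈ Q.lattice, g ≠ 0 :=
    ⟨_, Summit.AtomisticToContinuum.Crystallization.Theorems.ChargedEnergyGapNegative.Blocks.latVec_mem Q (fun _ => 1),
      Summit.AtomisticToContinuum.Crystallization.Theorems.ChargedEnergyGapNegative.Blocks.latVec_one_ne_zero Q⟩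
  have hg₁ : δ ≤ ‖g₁‖ := le_norm_of_mem_lattice Q hsep hg₁Λ hg₁0; have hg₁pos : 0 < ‖g₁‖ := hδ.trans_le hg₁; obtain ⟨N, hN⟩ := exists_nat_gt (2 * ρ / ‖g₁‖)
  have hNg : 2 * ρ < (N : ℝ) * ‖g₁‖ := by rwa [div_lt_iff₀ hg₁pos] at hN
  have hN0 : 0 ≤ (N : ℝ) * ‖g₁‖ := by positivity
  set C₁ : ℝ := (δ⁻¹ ^ 6 / 12 + 1 / 6) * (1024 / δ ^ 3) with hC₁; have hC₁0 : 0 ≤ C₁ := by positivity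
  obtain ⟨kk, hkk⟩ := exists_nat_gt ((2 * ρ + (N : ℝ) * ‖g₁‖ + (k : ℝ) * C₁ / γ + δ + 3) / δ); set K : ℕ := kk + 1 with hK_def
  have hKk : ((2 * ρ + (N : ℝ) * ‖g₁‖ + (k : ℝ) * C₁ / γ + δ + 3) / δ) < (K : ℝ) := hkk.trans (by rw [hK_def]; push_cast; linarith)
  have hKδ : 2 * ρ + (N : ℝ) * ‖g₁‖ + (k : ℝ) * C₁ / γ + δ + 3 < (K : ℝ) * δ := by rwa [div_lt_iff₀ hδ] at hKk
  have hkC : 0 ≤ (k : ℝ) * C₁ / γ := by positivity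
  set Rc : ℝ := (K : ℝ) * δ - 2 * ρ - 1 with hRc; have hRc1 : 1 ≤ Rc := by rw [hRc]; linarith
  have hRcδ : δ ≤ Rc := by rw [hRc]; linarith
  have hRcγ : (k : ℝ) * C₁ / γ < Rc := by rw [hRc]; linarith
  have hRc0 : 0 < Rc := by linarith
  clear_value Rc C₁ γ ρ; have hdij : ∀ i j, ‖xf i - xf j‖ ≤ 2 * ρ := fun i j => hd2 _ _ (hρx i) (hρx j); have hKδ' : 2 * ρ + (N : ℝ) * ‖g₁‖ + 1 < (K : ℝ) * δ := by linarith
  obtain ⟨P, hpts, hen, hlat⟩ := exists_supercell_points_energy Q K; have heP : P.energyPerParticle lennardJones = e := by rw [he_def, hen]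
  have hlong : ∀ g ∈ P.lattice, g ≠ 0 → (K : ℝ) * δ ≤ ‖g‖ := by
    intro g hg hg0; obtain ⟨g₀, hg₀, rfl⟩ := (hlat g).1 hg; have hg₀0 : g₀ ≠ 0 := fun h => hg0 (by rw [h, smul_zero])
    rw [norm_smul, Real.norm_natCast]; exact mul_le_mul_of_nonneg_left (le_norm_of_mem_lattice Q hsep hg₀ hg₀0) (Nat.cast_nonneg K)
  have hshort : ∀ g ∈ P.lattice, ‖g‖ < (K : ℝ) * δ → g = 0 := fun g hg hlt => by
    by_contra h; exact absurd (hlong g hg h) (not_le.2 hlt)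
  have hxP : ∀ i, xf i ∈ P.points := fun i => by rw [hpts]; exact hX (Set.mem_range_self i)
  choose m hm l hl hx using hxP
  have hminj : Function.Injective m := by
    intro i j hij; apply hxf; have h1 : xf i - xf j = l i - l j := by rw [hx i, hx j, hij]; abel
    have h2 : l i - l j ∈ P.lattice := P.lattice.sub_mem (hl i) (hl j); have h3 : ‖l i - l j‖ < (K : ℝ) * δ := by rw [← h1]; linarith [hdij i j]
    have h4 := hshort _ h2 h3; rw [← sub_eq_zero, h1, h4]
  set Bset : Finset E3 := Finset.univ.image m with hBset; set Aset : Finset E3 := P.motif \ Bset with hAset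
  have hBsub : Bset ⊆ P.motif := by
    intro b hb; obtain ⟨i, -, rfl⟩ := Finset.mem_image.1 hb; exact hm i
  have hAsub : Aset ⊆ P.motif := Finset.sdiff_subset
  have hcover : ∀ x ∈ P.motif, x ∈ Aset ∨ x ∈ Bset := fun x hx => by
    by_cases h : x ∈ Bset
    · exact Or.inr h
    · exact Or.inl (Finset.mem_sdiff.2 ⟨hx, h⟩)
  have hABdisj : Disjoint Aset Bset := Finset.sdiff_disjoint; have hBne : Bset.Nonempty := ⟨m ⟨0, hnpos⟩, Finset.mem_image_of_mem m (Finset.mem_univ _)⟩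
  have hAne : Aset.Nonempty := by
    set q₀ : E3 := xf ⟨0, hnpos⟩ + (N : ℝ) • g₁ with hq₀
    have hq₀Q : q₀ ∈ P.points := by
      rw [hpts, hq₀, Nat.cast_smul_eq_nsmul ℝ N g₁]; exact Q.add_mem_points (hX (Set.mem_range_self _)) (nsmul_mem hg₁Λ N)
    obtain ⟨y, hy, g, hg, hyg⟩ := hq₀Q; refine ⟨y, Finset.mem_sdiff.2 ⟨hy, fun hyB => ?_⟩⟩; obtain ⟨j, -, hj⟩ := Finset.mem_image.1 hyB
    have hdiff : q₀ - xf j = g - l j := by rw [hyg, hx j, ← hj]; abel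
    have hmem : q₀ - xf j ∈ P.lattice := by rw [hdiff]; exact P.lattice.sub_mem hg (hl j)
    have hnorm_le : ‖q₀ - xf j‖ < (K : ℝ) * δ := by
      have : q₀ - xf j = (xf ⟨0, hnpos⟩ - xf j) + (N : ℝ) • g₁ := by rw [hq₀]; abel
      rw [this]; refine (norm_add_le _ _).trans_lt ?_; rw [norm_smul, Real.norm_natCast]; linarith [hdij ⟨0, hnpos⟩ j, hKδ']
    have hnorm_pos : 0 < ‖q₀ - xf j‖ := by
      have : q₀ - xf j = (N : ℝ) • g₁ + (xf ⟨0, hnpos⟩ - xf j) := by rw [hq₀]; abel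
      rw [this]; have h1 : ‖(N : ℝ) • g₁‖ - ‖xf ⟨0, hnpos⟩ - xf j‖ ≤ ‖(N : ℝ) • g₁ + (xf ⟨0, hnpos⟩ - xf j)‖ := norm_sub_le_norm_add _ _; rw [norm_smul, Real.norm_natCast] at h1
      linarith [hdij ⟨0, hnpos⟩ j]
    have := hshort _ hmem hnorm_le; rw [this, norm_zero] at hnorm_pos; exact lt_irrefl _ hnorm_pos
  let A : PeriodicConfiguration 3 :=
    { lattice := P.lattice, discrete := P.discrete, isZLattice := P.isZLattice, motif := Aset, motif_nonempty := hAne,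
      eq_of_sub_mem := fun x hx y hy h => P.eq_of_sub_mem x (hAsub hx) y (hAsub hy) h }
  let B : PeriodicConfiguration 3 :=
    { lattice := P.lattice, discrete := P.discrete, isZLattice := P.isZLattice, motif := Bset, motif_nonempty := hBne,
      eq_of_sub_mem := fun x hx y hy h => P.eq_of_sub_mem x (hBsub hx) y (hBsub hy) h }
  have hAl : A.lattice = P.lattice := rfl; have hBl : B.lattice = P.lattice := rfl; have hunion : P.points = A.points ∪ B.points := points_eq_union hAl hBl hAsub hBsub hcover
  have hdisjAB : Disjoint A.points B.points := disjoint_points hAl hBl hAsub hBsub hABdisj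
  have hBpts : ∀ z : E3, z ∈ B.points ↔ ∃ j, ∃ g ∈ P.lattice, z = xf j + g := by
    intro z; constructor
    · rintro ⟨b, hb, g, hg, rfl⟩
      obtain ⟨j, -, rfl⟩ := Finset.mem_image.1 hb; refine ⟨j, g - l j, P.lattice.sub_mem hg (hl j), ?_⟩; rw [hx j]; abel
    · rintro ⟨j, g, hg, rfl⟩
      refine ⟨m j, Finset.mem_image_of_mem m (Finset.mem_univ j), g + l j, P.lattice.add_mem hg (hl j), ?_⟩; rw [hx j]; abel
  have hxB : ∀ i, xf i ∈ B.points := fun i => (hBpts _).2 ⟨i, 0, P.lattice.zero_mem, (add_zero _).symm⟩; have hxA : ∀ i, xf i ∉ A.points := fun i h => Set.disjoint_left.1 hdisjAB h (hxB i)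
  have hmB : ∀ i, m i ∈ B.points := fun i => B.mem_points_of_mem_motif (Finset.mem_image_of_mem m (Finset.mem_univ i))
  have hmA : ∀ i, m i ∉ A.points := fun i h => Set.disjoint_left.1 hdisjAB h (hmB i)
  have haB : ∀ x ∈ Aset, x ∉ B.points := fun x hx h => Set.disjoint_left.1 hdisjAB (A.mem_points_of_mem_motif hx) h
  have hfarB : ∀ z ∈ B.points, z ∉ Set.range xf → ∀ w : E3, ‖w‖ ≤ ρ → Rc < dist w z := by
    intro z hz hzr w hw; obtain ⟨j, g, hg, rfl⟩ := (hBpts z).1 hz; have hg0 : g ≠ 0 := fun h => hzr ⟨j, by rw [h, add_zero]⟩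
    have h1 := hlong g hg hg0
    have h2 : ‖g‖ - ‖w - xf j‖ ≤ dist w (xf j + g) := by
      rw [dist_eq_norm, show w - (xf j + g) = (w - xf j) - g by abel, norm_sub_rev (w - xf j) g]
      exact norm_sub_norm_le _ _ |>.trans (le_of_eq (by rw [norm_sub_rev]))
    have h3 := hd2 w (xf j) hw (hρx j); rw [hRc]; linarith
  have hfar : ∀ z ∈ B.points, z ∉ Set.range xf → ∀ i, 1 ≤ dist (xf i) z := fun z hz hzr i =>
    hRc1.trans (hfarB z hz hzr (xf i) (hρx i)).le
  have hRQ : ∀ i, R i ∈ Q.points → R i ∈ Set.range xf := fun i h => by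
    by_contra hr; exact Set.disjoint_left.1 hRdisj ⟨i, rfl⟩ ⟨h, hr⟩
  have hRA : ∀ i, R i ∉ A.points := fun i h => by
    have hQ : R i ∈ Q.points := by rw [← hpts, hunion]; exact Or.inl h
    obtain ⟨j, hj⟩ := hRQ i hQ; exact hxA j (hj ▸ h)
  set Rset : Finset E3 := Finset.univ.image R with hRset; have hRne : Rset.Nonempty := ⟨R ⟨0, hkpos⟩, Finset.mem_image_of_mem R (Finset.mem_univ _)⟩
  have hRAset : Disjoint Aset Rset := by
    rw [Finset.disjoint_left]; intro a ha haR; obtain ⟨i, -, rfl⟩ := Finset.mem_image.1 haR; exact hRA i (A.mem_points_of_mem_motif ha)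
  have hineqR : ∀ x ∈ Aset ∪ Rset, ∀ y ∈ Aset ∪ Rset, x - y ∈ P.lattice → x = y := by
    intro x hx y hy hxy; rcases Finset.mem_union.1 hx with hxA' | hxR <;> rcases Finset.mem_union.1 hy with hyA' | hyR
    · exact P.eq_of_sub_mem x (hAsub hxA') y (hAsub hyA') hxy
    · obtain ⟨i, -, rfl⟩ := Finset.mem_image.1 hyR
      exfalso; apply hRA i; exact ⟨x, hxA', -(x - R i), P.lattice.neg_mem hxy, by abel⟩
    · obtain ⟨i, -, rfl⟩ := Finset.mem_image.1 hxR
      exfalso; apply hRA i; exact ⟨y, hyA', R i - y, hxy, by abel⟩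
    · obtain ⟨i, -, rfl⟩ := Finset.mem_image.1 hxR
      obtain ⟨j, -, rfl⟩ := Finset.mem_image.1 hyR; have h3 : ‖R i - R j‖ < (K : ℝ) * δ := by linarith [hd2 _ _ (hρR i) (hρR j)]
      have h4 := hshort _ hxy h3; exact sub_eq_zero.1 h4
  let Rcf : PeriodicConfiguration 3 :=
    { lattice := P.lattice, discrete := P.discrete, isZLattice := P.isZLattice, motif := Rset, motif_nonempty := hRne,
      eq_of_sub_mem := fun x hx y hy h => hineqR x (Finset.mem_union_right _ hx) y (Finset.mem_union_right _ hy) h }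
  let Ap : PeriodicConfiguration 3 :=
    { lattice := P.lattice, discrete := P.discrete, isZLattice := P.isZLattice, motif := Aset ∪ Rset,
      motif_nonempty := hAne.mono Finset.subset_union_left, eq_of_sub_mem := hineqR }
  have hunion2 : Ap.points = A.points ∪ Rcf.points :=
    points_eq_union (P := Ap) (A := A) (B := Rcf) rfl rfl Finset.subset_union_left Finset.subset_union_right
      (fun x hx => Finset.mem_union.1 hx)
  have hdisj2 : Disjoint A.points Rcf.points :=
    disjoint_points (P := Ap) (A := A) (B := Rcf) rfl rfl Finset.subset_union_left Finset.subset_union_right hRAset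
  have hRpts : ∀ z : E3, z ∈ Rcf.points ↔ ∃ j, ∃ g ∈ P.lattice, z = R j + g := by
    intro z; constructor
    · rintro ⟨b, hb, g, hg, rfl⟩
      obtain ⟨j, -, rfl⟩ := Finset.mem_image.1 hb; exact ⟨j, g, hg, rfl⟩
    · rintro ⟨j, g, hg, rfl⟩
      exact ⟨R j, Finset.mem_image_of_mem R (Finset.mem_univ j), g, hg, rfl⟩
  have hRR : ∀ i, R i ∈ Rcf.points := fun i => (hRpts _).2 ⟨i, 0, P.lattice.zero_mem, (add_zero _).symm⟩
  have haR : ∀ x ∈ Aset, x ∉ Rcf.points := fun x hx h => Set.disjoint_left.1 hdisj2 (A.mem_points_of_mem_motif hx) h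
  have hfarR : ∀ z ∈ Rcf.points, z ∉ Set.range R → ∀ w : E3, ‖w‖ ≤ ρ → 1 ≤ dist w z := by
    intro z hz hzr w hw; obtain ⟨j, g, hg, rfl⟩ := (hRpts z).1 hz; have hg0 : g ≠ 0 := fun h => hzr ⟨j, by rw [h, add_zero]⟩
    have h1 := hlong g hg hg0
    have h2 : ‖g‖ - ‖w - R j‖ ≤ dist w (R j + g) := by
      rw [dist_eq_norm, show w - (R j + g) = (w - R j) - g by abel, norm_sub_rev (w - R j) g]
      exact norm_sub_norm_le _ _ |>.trans (le_of_eq (by rw [norm_sub_rev]))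
    have h3 := hd2 w (R j) hw (hρR j); linarith
  set siteP : E3 → ℝ := fun x => ∑' y : {y : E3 // y ∈ P.points ∧ y ≠ x}, lennardJones (dist x y.1) with hsiteP
  set siteA : E3 → ℝ := fun x => ∑' y : {y : E3 // y ∈ A.points ∧ y ≠ x}, lennardJones (dist x y.1) with hsiteA
  set siteB : E3 → ℝ := fun x => ∑' y : {y : E3 // y ∈ B.points ∧ y ≠ x}, lennardJones (dist x y.1) with hsiteB
  set siteAp : E3 → ℝ := fun x => ∑' y : {y : E3 // y ∈ Ap.points ∧ y ≠ x}, lennardJones (dist x y.1) with hsiteAp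
  set siteR : E3 → ℝ := fun x => ∑' y : {y : E3 // y ∈ Rcf.points ∧ y ≠ x}, lennardJones (dist x y.1) with hsiteR
  set G : Fin n → ℝ := fun i => ∑' z : ↥(B.points \ Set.range xf), lennardJones (dist (xf i) z) with hG
  set GR : Fin k → ℝ := fun i => ∑' z : ↥(B.points \ Set.range xf), lennardJones (dist (R i) z) with hGR
  set H : Fin k → ℝ := fun i => ∑' z : ↥(Rcf.points \ Set.range R), lennardJones (dist (R i) z) with hH
  set I : Fin n → ℝ := fun i => ∑' y : ↥(Q.points \ Set.range xf), lennardJones (dist (xf i) y) with hI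
  set IR : Fin k → ℝ := fun i => ∑' y : ↥(Q.points \ Set.range xf), lennardJones (dist (R i) y) with hIR
  set SA : Fin n → ℝ := fun i => ∑' z : {z : E3 // z ∈ A.points ∧ z ≠ xf i}, lennardJones (dist (xf i) z.1) with hSA
  set SAR : Fin k → ℝ := fun i => ∑' z : {z : E3 // z ∈ A.points ∧ z ≠ R i}, lennardJones (dist (R i) z.1) with hSAR
  have hE1 : 2 * (P.motif.card : ℝ) * e = ∑ x ∈ Aset, siteP x + ∑ x ∈ Bset, siteP x := by
    rw [← heP, twice_card_mul_energyPerParticle, ← Finset.sum_union hABdisj, hAset, Finset.sdiff_union_of_subset hBsub]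
  have hE3 : ∑ x ∈ Bset, siteP x = ∑ i, siteP (xf i) := by
    rw [hBset, Finset.sum_image (fun i _ j _ h => hminj h)]; refine Finset.sum_congr rfl fun i _ => ?_; simp only [hsiteP]
    exact (tsum_site_eq_of_sub_mem_lattice P lennardJones (x := m i) (x' := xf i)
      (by rw [hx i, add_sub_cancel_left]; exact hl i)).symm
  have hE5 : ∑ x ∈ Aset, siteP x = ∑ x ∈ Aset, siteA x + ∑ x ∈ Aset, siteB x := by
    rw [← Finset.sum_add_distrib]; exact Finset.sum_congr rfl fun x _ => tsum_site_split P hunion hdisjAB x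
  have hE6 : ∀ x ∈ Aset, siteB x = ∑ i, ∑' l : ↥P.lattice, lennardJones (dist (m i) (x + (l : E3))) := by
    intro x hx; simp only [hsiteB]; rw [tsum_points_eq_sum_tsum_lattice B (haB x hx)]; show ∑ b ∈ Bset, ∑' l : ↥P.lattice, lennardJones (dist x (b + (l : E3))) = _
    rw [hBset, Finset.sum_image (fun i _ j _ h => hminj h)]; exact Finset.sum_congr rfl fun i _ => tsum_lattice_symm P.lattice lennardJones x (m i)
  have hE8 : ∀ i, ∑ x ∈ Aset, ∑' l : ↥P.lattice, lennardJones (dist (m i) (x + (l : E3))) = SA i := by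
    intro i; have h1 := tsum_points_eq_sum_tsum_lattice A (hmA i); rw [← h1]; simp only [hSA]; exact (tsum_site_eq_of_sub_mem_lattice A lennardJones (x := m i) (x' := xf i)
      (by rw [hx i, add_sub_cancel_left]; exact hl i)).symm
  have hE68 : ∑ x ∈ Aset, siteB x = ∑ i, SA i := by
    rw [Finset.sum_congr rfl hE6, Finset.sum_comm]; exact Finset.sum_congr rfl fun i _ => hE8 i
  have hE9 : ∀ i, siteP (xf i) = SA i + siteB (xf i) := fun i => tsum_site_split P hunion hdisjAB (xf i)
  have hsetB : ∀ i, {z : E3 | z ∈ B.points ∧ z ≠ xf i} = (↑((Finset.univ.erase i).image xf) : Set E3) ∪ (B.points \ Set.range xf) := by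
    intro i; ext z; rw [Set.mem_setOf_eq, Set.mem_union, Finset.mem_coe, Finset.mem_image, Set.mem_sdiff, Set.mem_range]; constructor
    · rintro ⟨hz, hzi⟩
      by_cases hr : ∃ j, xf j = z
      · obtain ⟨j, rfl⟩ := hr
        exact Or.inl ⟨j, Finset.mem_erase.2 ⟨fun h => hzi (by rw [h]), Finset.mem_univ j⟩, rfl⟩
      · exact Or.inr ⟨hz, hr⟩
    · rintro (⟨j, hj, rfl⟩ | ⟨hz, hr⟩)
      · exact ⟨hxB j, fun h => (Finset.mem_erase.1 hj).1 (hxf h)⟩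
      · exact ⟨hz, fun h => hr ⟨i, h.symm⟩⟩
  have hdisjB : ∀ i, Disjoint (↑((Finset.univ.erase i).image xf) : Set E3) (B.points \ Set.range xf) := by
    intro i; rw [Set.disjoint_left]; rintro z hz ⟨-, hr⟩; rw [Finset.mem_coe, Finset.mem_image] at hz; obtain ⟨j, -, rfl⟩ := hz; exact hr ⟨j, rfl⟩
  have hE10 : ∀ i, siteB (xf i) = ∑ j ∈ Finset.univ.erase i, lennardJones (dist (xf i) (xf j)) + G i := by
    intro i; simp only [hsiteB, hG]; have hS1 : Summable ((fun z : E3 => lennardJones (dist (xf i) z)) ∘ (↑) : (↑((Finset.univ.erase i).image xf) : Set E3) → ℝ) :=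
      summable_lennardJones_subset P (xf i) (fun z hz => by
        have hz' : z ∈ {z : E3 | z ∈ B.points ∧ z ≠ xf i} := by rw [hsetB i]; exact Or.inl hz
        exact ⟨by rw [hunion]; exact Or.inr hz'.1, hz'.2⟩)
    have hS2 : Summable ((fun z : E3 => lennardJones (dist (xf i) z)) ∘ (↑) : (B.points \ Set.range xf : Set E3) → ℝ) :=
      summable_lennardJones_subset P (xf i) (fun z hz => by
        have hz' : z ∈ {z : E3 | z ∈ B.points ∧ z ≠ xf i} := by rw [hsetB i]; exact Or.inr hz
        exact ⟨by rw [hunion]; exact Or.inr hz'.1, hz'.2⟩)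
    have h := hS1.tsum_union_disjoint (hdisjB i) hS2; rw [← tsum_congr_set_coe (fun z : E3 => lennardJones (dist (xf i) z)) (hsetB i)] at h
    have hfin : ∑' x : (↑((Finset.univ.erase i).image xf) : Set E3), lennardJones (dist (xf i) x) = ∑ x ∈ (Finset.univ.erase i).image xf, lennardJones (dist (xf i) x) :=
      Finset.tsum_subtype' _ (fun z => lennardJones (dist (xf i) z))
    rw [hfin, Finset.sum_image (fun j _ k _ hjk => hxf hjk)] at h; exact h
  have hGle : ∀ i, G i ≤ 0 := fun i => by
    simp only [hG]; exact tsum_nonpos fun z => lennardJones_nonpos (hfar z.1 z.2.1 z.2.2 i)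
  have hsetQ : Q.points \ Set.range xf = A.points ∪ (B.points \ Set.range xf) := by
    rw [← hpts, hunion]; ext z; simp only [Set.mem_sdiff, Set.mem_union]; constructor
    · rintro ⟨hz | hz, hr⟩
      · exact Or.inl hz
      · exact Or.inr ⟨hz, hr⟩
    · rintro (hz | ⟨hz, hr⟩)
      · refine ⟨Or.inl hz, fun ⟨j, hj⟩ => hxA j ?_⟩
        rw [hj]; exact hz
      · exact ⟨Or.inr hz, hr⟩
  have hdisjQ : Disjoint A.points (B.points \ Set.range xf) :=
    Set.disjoint_of_subset_right Set.sdiff_subset hdisjAB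
  have hE11 : ∀ i, I i = SA i + G i := by
    intro i; simp only [hI, hSA, hG]; have hS1 : Summable ((fun z : E3 => lennardJones (dist (xf i) z)) ∘ (↑) : A.points → ℝ) :=
      summable_lennardJones_subset P (xf i) (fun z hz => ⟨by rw [hunion]; exact Or.inl hz, fun h => hxA i (h ▸ hz)⟩)
    have hS2 : Summable ((fun z : E3 => lennardJones (dist (xf i) z)) ∘ (↑) : (B.points \ Set.range xf : Set E3) → ℝ) :=
      summable_lennardJones_subset P (xf i) (fun z hz => ⟨by rw [hunion]; exact Or.inr hz.1, fun h => hz.2 ⟨i, h.symm⟩⟩)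
    have h := hS1.tsum_union_disjoint hdisjQ hS2; rw [← tsum_congr_set_coe (fun z : E3 => lennardJones (dist (xf i) z)) hsetQ] at h
    rw [← tsum_congr_set_coe (fun z : E3 => lennardJones (dist (xf i) z)) (setOf_points_ne_eq (hxA i))] at h; exact h
  have hE12 : 2 * interactionEnergy lennardJones xf = ∑ i, ∑ j ∈ Finset.univ.erase i, lennardJones (dist (xf i) (xf j)) :=
    two_mul_interactionEnergy lennardJones xf
  have hcardAp : (Aset ∪ Rset).card = Aset.card + k := by
    rw [Finset.card_union_of_disjoint hRAset, hRset, Finset.card_image_of_injective _ hR, Finset.card_univ, Fintype.card_fin]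
  have hE13 : 2 * ((Aset.card : ℝ) + k) * Ap.energyPerParticle lennardJones = ∑ x ∈ Aset, siteAp x + ∑ i, siteAp (R i) := by
    have h := twice_card_mul_energyPerParticle Ap lennardJones; have hm : Ap.motif = Aset ∪ Rset := rfl
    rw [hm, hcardAp, Nat.cast_add, Finset.sum_union hRAset, hRset, Finset.sum_image (fun i _ j _ h => hR h)] at h; exact h
  have hE13' : 2 * ((Aset.card : ℝ) + k) * e ≤ 2 * ((Aset.card : ℝ) + k) * Ap.energyPerParticle lennardJones := by
    have h0 : (⨅ Q' : PeriodicConfiguration 3, Q'.energyPerParticle lennardJones) ≤ Ap.energyPerParticle lennardJones := eStar_le Ap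
    have h1 : e ≤ Ap.energyPerParticle lennardJones := heq ▸ h0
    have h2 : (0 : ℝ) ≤ 2 * ((Aset.card : ℝ) + k) := by
      have ha : (0 : ℝ) ≤ Aset.card := Nat.cast_nonneg _; have hb : (0 : ℝ) ≤ k := Nat.cast_nonneg _; linarith
    exact mul_le_mul_of_nonneg_left h1 h2
  have hE14 : ∑ x ∈ Aset, siteAp x = ∑ x ∈ Aset, siteA x + ∑ x ∈ Aset, siteR x := by
    rw [← Finset.sum_add_distrib]; exact Finset.sum_congr rfl fun x _ => tsum_site_split Ap hunion2 hdisj2 x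
  have hE15 : ∀ x ∈ Aset, siteR x = ∑ i, ∑' l : ↥P.lattice, lennardJones (dist (R i) (x + (l : E3))) := by
    intro x hx; simp only [hsiteR]; rw [tsum_points_eq_sum_tsum_lattice Rcf (haR x hx)]; show ∑ b ∈ Rset, ∑' l : ↥P.lattice, lennardJones (dist x (b + (l : E3))) = _
    rw [hRset, Finset.sum_image (fun i _ j _ h => hR h)]; exact Finset.sum_congr rfl fun i _ => tsum_lattice_symm P.lattice lennardJones x (R i)
  have hE16 : ∀ i, ∑ x ∈ Aset, ∑' l : ↥P.lattice, lennardJones (dist (R i) (x + (l : E3))) = SAR i := by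
    intro i; rw [← tsum_points_eq_sum_tsum_lattice A (hRA i)]
  have hE1416 : ∑ x ∈ Aset, siteR x = ∑ i, SAR i := by
    rw [Finset.sum_congr rfl hE15, Finset.sum_comm]; exact Finset.sum_congr rfl fun i _ => hE16 i
  have hE17 : ∀ i, siteAp (R i) = SAR i + siteR (R i) := fun i => tsum_site_split Ap hunion2 hdisj2 (R i)
  have hsetR : ∀ i, {z : E3 | z ∈ Rcf.points ∧ z ≠ R i} = (↑((Finset.univ.erase i).image R) : Set E3) ∪ (Rcf.points \ Set.range R) := by
    intro i; ext z; rw [Set.mem_setOf_eq, Set.mem_union, Finset.mem_coe, Finset.mem_image, Set.mem_sdiff, Set.mem_range]; constructor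
    · rintro ⟨hz, hzi⟩
      by_cases hr : ∃ j, R j = z
      · obtain ⟨j, rfl⟩ := hr
        exact Or.inl ⟨j, Finset.mem_erase.2 ⟨fun h => hzi (by rw [h]), Finset.mem_univ j⟩, rfl⟩
      · exact Or.inr ⟨hz, hr⟩
    · rintro (⟨j, hj, rfl⟩ | ⟨hz, hr⟩)
      · exact ⟨hRR j, fun h => (Finset.mem_erase.1 hj).1 (hR h)⟩
      · exact ⟨hz, fun h => hr ⟨i, h.symm⟩⟩
  have hdisjR : ∀ i, Disjoint (↑((Finset.univ.erase i).image R) : Set E3) (Rcf.points \ Set.range R) := by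
    intro i; rw [Set.disjoint_left]; rintro z hz ⟨-, hr⟩; rw [Finset.mem_coe, Finset.mem_image] at hz; obtain ⟨j, -, rfl⟩ := hz; exact hr ⟨j, rfl⟩
  have hE18 : ∀ i, siteR (R i) = ∑ j ∈ Finset.univ.erase i, lennardJones (dist (R i) (R j)) + H i := by
    intro i; simp only [hsiteR, hH]; have hsub : {z : E3 | z ∈ Rcf.points ∧ z ≠ R i} ⊆ {y : E3 | y ∈ Ap.points ∧ y ≠ R i} := fun z hz =>
      ⟨by rw [hunion2]; exact Or.inr hz.1, hz.2⟩
    have hS1 : Summable ((fun z : E3 => lennardJones (dist (R i) z)) ∘ (↑) : (↑((Finset.univ.erase i).image R) : Set E3) → ℝ) :=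
      summable_lennardJones_subset Ap (R i) (fun z hz => hsub (by rw [hsetR i]; exact Or.inl hz))
    have hS2 : Summable ((fun z : E3 => lennardJones (dist (R i) z)) ∘ (↑) : (Rcf.points \ Set.range R : Set E3) → ℝ) :=
      summable_lennardJones_subset Ap (R i) (fun z hz => hsub (by rw [hsetR i]; exact Or.inr hz))
    have h := hS1.tsum_union_disjoint (hdisjR i) hS2; rw [← tsum_congr_set_coe (fun z : E3 => lennardJones (dist (R i) z)) (hsetR i)] at h
    have hfin : ∑' x : (↑((Finset.univ.erase i).image R) : Set E3), lennardJones (dist (R i) x) = ∑ x ∈ (Finset.univ.erase i).image R, lennardJones (dist (R i) x) :=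
      Finset.tsum_subtype' _ (fun z => lennardJones (dist (R i) z))
    rw [hfin, Finset.sum_image (fun j _ l _ hjl => hR hjl)] at h; exact h
  have hHle : ∀ i, H i ≤ 0 := fun i => by
    simp only [hH]; exact tsum_nonpos fun z => lennardJones_nonpos (hfarR z.1 z.2.1 z.2.2 (R i) (hρR i))
  have hE19 : ∀ i, IR i = SAR i + GR i := by
    intro i; simp only [hIR, hSAR, hGR]; have hS1 : Summable ((fun z : E3 => lennardJones (dist (R i) z)) ∘ (↑) : A.points → ℝ) :=
      summable_lennardJones_subset P (R i) (fun z hz => ⟨by rw [hunion]; exact Or.inl hz, fun h => hRA i (h ▸ hz)⟩)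
    have hS2 : Summable ((fun z : E3 => lennardJones (dist (R i) z)) ∘ (↑) : (B.points \ Set.range xf : Set E3) → ℝ) :=
      summable_lennardJones_subset P (R i) (fun z hz => ⟨by rw [hunion]; exact Or.inr hz.1, fun h => ?_⟩)
    swap
    · -- `z = R i` would be a point of `Q` off `range xf`, excluded by the disjointness hypothesis
      have hzQ : z ∈ Q.points := by rw [← hpts, hunion]; exact Or.inr hz.1
      exact Set.disjoint_left.1 hRdisj ⟨i, h.symm⟩ ⟨hzQ, hz.2⟩
    have h := hS1.tsum_union_disjoint hdisjQ hS2; rw [← tsum_congr_set_coe (fun z : E3 => lennardJones (dist (R i) z)) hsetQ] at h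
    rw [← tsum_congr_set_coe (fun z : E3 => lennardJones (dist (R i) z)) (setOf_points_ne_eq (hRA i))] at h; exact h
  have hGRle : ∀ i, |GR i| ≤ C₁ / Rc := by
    intro i; simp only [hGR]; have h := abs_tsum_lennardJones_sub_sum_le (X := Q.points) (Y := B.points \ Set.range xf) hδ hsep
      (fun z hz => by rw [← hpts, hunion]; exact Or.inr hz.1) (R i) hRcδ ∅ (fun y => by
        simp only [Finset.notMem_empty, false_iff, not_and, not_le]; exact fun hy => hfarB y hy.1 hy.2 (R i) (hρR i))
    rw [Finset.sum_empty, sub_zero] at h; refine h.trans ?_; rw [hC₁]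
    have h1 : Rc ≤ Rc ^ 3 := by
      have ha : Rc * 1 ≤ Rc * Rc := mul_le_mul_of_nonneg_left hRc1 hRc0.le; have hb : Rc * Rc * 1 ≤ Rc * Rc * Rc := mul_le_mul_of_nonneg_left hRc1 (mul_nonneg hRc0.le hRc0.le)
      calc Rc = Rc * 1 := (mul_one _).symm
        _ ≤ Rc * Rc := ha
        _ = Rc * Rc * 1 := (mul_one _).symm
        _ ≤ Rc * Rc * Rc := hb
        _ = Rc ^ 3 := by ring
    have hδ3 : 0 < δ ^ 3 := pow_pos hδ 3
    have h2 : (1024 : ℝ) / (δ ^ 3 * Rc ^ 3) ≤ 1024 / δ ^ 3 / Rc := by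
      rw [div_div]; exact div_le_div_of_nonneg_left (by norm_num) (mul_pos hδ3 hRc0) (mul_le_mul_of_nonneg_left h1 hδ3.le)
    have h3 : (0 : ℝ) ≤ δ⁻¹ ^ 6 / 12 + 1 / 6 :=
      add_nonneg (div_nonneg (pow_nonneg (inv_nonneg.2 hδ.le) 6) (by norm_num)) (by norm_num)
    calc (δ⁻¹ ^ 6 / 12 + 1 / 6) * (1024 / (δ ^ 3 * Rc ^ 3)) ≤ (δ⁻¹ ^ 6 / 12 + 1 / 6) * (1024 / δ ^ 3 / Rc) := mul_le_mul_of_nonneg_left h2 h3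
      _ = (δ⁻¹ ^ 6 / 12 + 1 / 6) * (1024 / δ ^ 3) / Rc := by ring
  have hE20 : 2 * interactionEnergy lennardJones R = ∑ i, ∑ j ∈ Finset.univ.erase i, lennardJones (dist (R i) (R j)) :=
    two_mul_interactionEnergy lennardJones R
  have hcardB : Bset.card = n := by
    rw [hBset, Finset.card_image_of_injective _ hminj, Finset.card_univ, Fintype.card_fin]
  have hcardA : (Aset.card : ℝ) + n = P.motif.card := by
    have h := Finset.card_sdiff_add_card_eq_card hBsub; rw [← hAset, hcardB] at h; exact_mod_cast h
  have hsum9 : ∑ i, siteP (xf i) = ∑ i, SA i + ∑ i, siteB (xf i) := by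
    rw [← Finset.sum_add_distrib]; exact Finset.sum_congr rfl fun i _ => hE9 i
  have hsum10 : ∑ i, siteB (xf i) = ∑ i, ∑ j ∈ Finset.univ.erase i, lennardJones (dist (xf i) (xf j)) + ∑ i, G i := by
    rw [← Finset.sum_add_distrib]; exact Finset.sum_congr rfl fun i _ => hE10 i
  have hsum11 : ∑ i, I i = ∑ i, SA i + ∑ i, G i := by
    rw [← Finset.sum_add_distrib]; exact Finset.sum_congr rfl fun i _ => hE11 i
  have hsum17 : ∑ i, siteAp (R i) = ∑ i, SAR i + ∑ i, siteR (R i) := by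
    rw [← Finset.sum_add_distrib]; exact Finset.sum_congr rfl fun i _ => hE17 i
  have hsum18 : ∑ i, siteR (R i) = ∑ i, ∑ j ∈ Finset.univ.erase i, lennardJones (dist (R i) (R j)) + ∑ i, H i := by
    rw [← Finset.sum_add_distrib]; exact Finset.sum_congr rfl fun i _ => hE18 i
  have hsum19 : ∑ i, IR i = ∑ i, SAR i + ∑ i, GR i := by
    rw [← Finset.sum_add_distrib]; exact Finset.sum_congr rfl fun i _ => hE19 i
  have hGsum : ∑ i, G i ≤ 0 := Finset.sum_nonpos fun i _ => hGle i; have hHsum : ∑ i, H i ≤ 0 := Finset.sum_nonpos fun i _ => hHle i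
  have hGRsum : -(∑ i, GR i) ≤ (k : ℝ) * (C₁ / Rc) := by
    have h1 : -(∑ i, GR i) ≤ ∑ i : Fin k, (C₁ / Rc) := by
      rw [← Finset.sum_neg_distrib]; exact Finset.sum_le_sum fun i _ => (neg_le_abs _).trans (hGRle i)
    rw [Finset.sum_const, Finset.card_univ, Fintype.card_fin, nsmul_eq_mul] at h1; exact h1
  have htail : (k : ℝ) * (C₁ / Rc) < γ := by
    rw [← mul_div_assoc, div_lt_iff₀ hRc0]; have := (div_lt_iff₀ hγpos).1 hRcγ; linarith only [this]
  have hv : Δ < e * ((k : ℝ) - n) := hviol; have hΔ' : Δ = (interactionEnergy lennardJones R + ∑ i, IR i) - (interactionEnergy lennardJones xf + ∑ i, I i) := by rw [hΔ]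
  have hcardA' : 2 * (Aset.card : ℝ) * e + 2 * (n : ℝ) * e = 2 * (P.motif.card : ℝ) * e := by rw [← hcardA]; ring
  have hcardAp' : 2 * ((Aset.card : ℝ) + k) * e = 2 * (Aset.card : ℝ) * e + 2 * (k : ℝ) * e := by ring
  linarith only [hE1, hE3, hE5, hE68, hsum9, hsum10, hsum11, hGsum, hE12, hcardA', hE13, hE13', hE14, hE1416, hsum17, hsum18,
    hsum19, hHsum, hGRsum, htail, hv, hΔ', hcardAp', hγ, hE20]

end Summit.AtomisticToContinuum.Crystallization.Theorems.FrustratedLawDichotomyPeriodicSurgeryTest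

end
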